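import Summits.QuantumFields.BalabanUV.Beta.EriceRemainderEnclosureHistoryAutonomyComparisonAgeCompositionUpwardChainFlow

/-!
# EriceRemainderEnclosureHistoryAutonomyComparisonAgeCompositionShiftMonotoneFading — (E111k) route (N), first order: THE STOCHASTICALLY MONOTONE END, AND EVERY
# FADING PROFILE AT EVERY RANGE (undamped first-order model).  A technique-distinct one-liner next to the tower stations: in the language of (E98a) the first-order
# system `ε_m = e_m − Σ_l A_m(l)·ε_{m+1+l}` (`A_m(l)` = the aggregate row, i.e. the TAIL `Σ_{k>l} c_k(m)` of the upward chain's jump law at the pin `m`) has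
# `0 ≤ ε ≤ e` for EVERY non-negative non-increasing excess as soon as the jump law is STOCHASTICALLY MONOTONE in the pin — the shift domination ACROSS PINS
# `A_m(l+1) ≤ A_{m+1}(l)` (**`renewal_nonneg_of_shift_monotone`**; no mass hypothesis beyond `A_m(0) ≤ 1`, no horizon hypothesis): differencing the renewal equation
# gives `ε_m ≥ (e_m − e_{m+1}) + (1 − A_m(0))·ε_{m+1} + Σ_{l≥1} (A_{m+1}(l−1) − A_m(l))·ε_{m+1+l}` — the chain started one pin deeper is stochastically LARGER, so it
# collects no more of a non-increasing reward (README `HOME/b2b-balaban-beta-d4-p2/g92/README.md` §5, the «homogeneous chain» remark made quantitative).  Along an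
# UNDAMPED box flow the aggregate tails are `Σ_{k>l} L_kh_{m+k}³∕2` ((E98c) `aggregate_undamped_tail`), and the shift domination holds termwise, `L_{k+1}h_{m+k+1}³ ≤
# L_kh_{m+1+k}³`, exactly when the profile is FADING from age one on, `L_{k+1} ≤ L_k` (`k ≥ 1`) (**`flow_shift_monotone_of_fading`**) — hence
# **`flow_nonneg_fading_undamped`**: EVERY fading profile, EVERY range `K`, every horizon, every admissible excess: `0 ≤ ε ≤ e` in the undamped first-order model.
# The census so far reached fading profiles only through (E90d) (`K ≤ 53`, any shape) at first order; the nonlinear comparison for fading memories is (E60a).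
# NOT CLAIMED: the damped classes (there the `Γ`-weighted chain of (E98c) has INCREASING rewards `e∕Γ` and the same differencing needs `ε_{m+1} ≥ f_m·e_{m+1}` at the
# next pin — README g92 §5; open), anything nonlinear, anything printed.

Cell `pub-balaban`, β-function sub-cell, BINDER row D4 «RemainderConst leaves for Bałaban's split» (`HOME/BINDER-OWNERS.md`; owner lineage `b2b-balaban-beta-an4`;
this file by co-owner #2 lineage `b2b-balaban-beta-d4-p2`, generation 92), β-FLOW TEAM duty (1), FREEZE (0) honoured (def-free; nothing restated).

HONEST FRAMING (page 1, verbatim and binding).  *"Discharging BetaPertH makes Bałaban's UV stability UNCONDITIONAL — a real constructive-QFT result; it is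
NOT the continuum limit and NOT the Clay problem."*  THIS FILE DISCHARGES NOTHING OF THE KIND.  Elementary real algebra ∕ real analysis about ABSTRACT
functionals on a box ]0,γ]^ℕ with displayed floors, profiles and signs, and the FIRST-ORDER renewal objects of route (N) built from them — hypotheses of a
census, not facts; the form, signs, ages and moments of Bałaban's (1.22) limit functional (in particular whether its age profile fades) are NOT PRINTED ([I] p. 298;
GAPS G-t4-U2-1∕-2) and NOT asserted.  Row D4 class UNCHANGED (critical-path width 0; instance 0∕1; D4 DISCHARGE NO DATE).  HONEST DEPENDENCY: continuum YM on T⁴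
⇐ BetaPertH ∧ nine spine estimates (0/9 proved); BetaPertH ⇐ (D1) ∧ (D4) ∧ CAP+tail; G-an2-4 gates asym, D1 and NE2/3/4.

THE POINT (README `HOME/b2b-balaban-beta-d4-p2/g92/README.md` §5).  Uses (E98c) `aggregate_undamped_tail`, (E98a) `tail_nonneg_of_anti` BY NAME.  NOT CLAIMED: any damping
`g ≢ 1`; anything printed — NOT B12 Thm 2, NOT BetaPertH, NOT continuum, NOT Clay.

WHAT IS PROVED ([folklore]; 0 `def`, 0 sorry).  §1 **`renewal_nonneg_of_shift_monotone`** (pure).  §2 **`flow_shift_monotone_of_fading`**, **`flow_nonneg_fading_undamped`**.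
-/
noncomputable section
open Finset

namespace Summit.QuantumFields.BalabanUV.Beta.EriceRemainderEnclosureHistoryAutonomyComparisonAgeCompositionShiftMonotoneFading

open Literature.MathematicalPhysics.QuantumFieldTheory.Balaban1983to89
open Literature.MathematicalPhysics.QuantumFieldTheory.Balaban1983to89.T4BetaStationary
open Literature.MathematicalPhysics.QuantumFieldTheory.Balaban1983to89.T4BetaFlowWellPosed
open Summit.QuantumFields.BalabanUV.Beta.EriceRemainderEnclosureHistoryAutonomyComparisonAgeCompositionUpwardChain (tail_nonneg_of_anti)
open Summit.QuantumFields.BalabanUV.Beta.EriceRemainderEnclosureHistoryAutonomyComparisonAgeCompositionUpwardChainFlow (aggregate_undamped_tail)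

/-! ## §1 The stochastically monotone END (pure) -/

/-- **THE STOCHASTICALLY MONOTONE END.**  Rows `A m l ≥ 0` vanishing for `l ≥ Kw`, first entry `A m 0 ≤ 1`, and the SHIFT DOMINATION ACROSS PINS
`A m (l+1) ≤ A (m+1) l` (the upward chain's jump law is stochastically non-decreasing in the pin); reads `R v m = Σ_{l<Kw} A m l·v(m+1+l)`; `e ≥ 0` non-increasing;
`ε` the zero-tailed solution of `ε = e − R ε`.  THEN `0 ≤ ε ≤ e` at every pin: differencing the equations at `m` and `m+1`, `ε_m ≥ (e_m − e_{m+1}) + (1 − A m 0)·ε_{m+1}`.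
[folklore] -/
theorem renewal_nonneg_of_shift_monotone {Kw N : ℕ} {A : ℕ → ℕ → ℝ} {R : (ℕ → ℝ) → ℕ → ℝ} {e ε : ℕ → ℝ}
    (hA0 : ∀ m l, 0 ≤ A m l) (hAtop : ∀ m l, Kw ≤ l → A m l = 0) (hA1 : ∀ m, A m 0 ≤ 1) (hshift : ∀ m l, A m (l + 1) ≤ A (m + 1) l)
    (hR : ∀ v m, R v m = ∑ l ∈ range Kw, A m l * v (m + 1 + l)) (he0 : ∀ m, 0 ≤ e m) (hea : ∀ m, e (m + 1) ≤ e m)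
    (hεt : ∀ m, N < m → ε m = 0) (hrec : ∀ m, ε m = e m - R ε m) : ∀ m, 0 ≤ ε m ∧ ε m ≤ e m := by
  suffices step : ∀ m, (∀ q, m < q → 0 ≤ ε q ∧ ε q ≤ e q) → 0 ≤ ε m ∧ ε m ≤ e m by
    have main : ∀ n m, N < m + n → 0 ≤ ε m ∧ ε m ≤ e m := by
      intro n
      induction n with
      | zero => intro m hm; rw [hεt m (by omega)]; exact ⟨le_rfl, he0 m⟩
      | succ n ih => intro m hm; exact step m fun q hq => ih q (by omega)
    exact fun m => main (N + 1) m (by omega)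
  intro m IH
  have hRnn : ∀ p, m ≤ p → 0 ≤ R ε p := fun p hp => by
    rw [hR]; exact sum_nonneg fun l _ => mul_nonneg (hA0 p l) (IH _ (by omega)).1
  refine ⟨?_, by rw [hrec m]; linarith [hRnn m le_rfl]⟩
  -- the lower bound: difference the equations at m and m+1
  rcases Nat.eq_zero_or_pos Kw with hK0 | hKpos
  · have : R ε m = 0 := by rw [hR, hK0, sum_range_zero]
    rw [hrec m, this, sub_zero]; exact he0 m
  obtain ⟨n, rfl⟩ : ∃ n, Kw = n + 1 := ⟨Kw - 1, by omega⟩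
  have hε1 := (IH (m + 1) (by omega)).1
  -- R ε m = A m 0 ε_{m+1} + Σ_{j<n} A m (j+1) ε_{m+2+j}
  have hRm : R ε m = A m 0 * ε (m + 1) + ∑ j ∈ range n, A m (j + 1) * ε (m + 2 + j) := by
    rw [hR, sum_range_succ', add_comm, add_zero]
    congr 1
    exact sum_congr rfl fun j _ => by rw [show m + 1 + (j + 1) = m + 2 + j by omega]
  -- R ε (m+1) ≥ Σ_{j<n} A (m+1) j ε_{m+2+j} ≥ Σ_{j<n} A m (j+1) ε_{m+2+j}
  have hRm1 : ∑ j ∈ range n, A m (j + 1) * ε (m + 2 + j) ≤ R ε (m + 1) := by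
    rw [hR, sum_range_succ]
    have hlast : 0 ≤ A (m + 1) n * ε (m + 1 + 1 + n) := mul_nonneg (hA0 _ _) (IH _ (by omega)).1
    have hsum : ∑ j ∈ range n, A m (j + 1) * ε (m + 2 + j) ≤ ∑ j ∈ range n, A (m + 1) j * ε (m + 1 + 1 + j) :=
      sum_le_sum fun j _ => by
        rw [show m + 1 + 1 + j = m + 2 + j by omega]
        exact mul_le_mul_of_nonneg_right (hshift m j) (IH _ (by omega)).1
    linarith
  have hrec1 : R ε (m + 1) = e (m + 1) - ε (m + 1) := by have := hrec (m + 1); linarith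
  have hA1m := hA1 m
  rw [hrec m, hRm]
  nlinarith [hea m, mul_nonneg (sub_nonneg.2 hA1m) hε1]

/-! ## §2 Fading profiles along undamped flows -/

variable {B : (ℕ → ℝ) → ℝ} {γ b gIR : ℝ} {L : ℕ → ℝ} {K : ℕ} {h : ℕ → ℝ}

/-- **A FADING PROFILE MAKES THE UNDAMPED CHAIN STOCHASTICALLY MONOTONE.**  Along a box flow of an isotone memory with floor dominating `L ≥ 0` (`L_0 = 0`), with the
undamped lone kernels `KL` and their aggregates `KA`: if `L (k+1) ≤ L k` for every `k ≥ 1`, then `KA 1 m (l+1) ≤ KA 1 (m+1) l` for all `m, l` — termwise,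
`L_{j+2}h_{m+j+2}³ ≤ L_{j+1}h_{m+j+2}³`, through (E98c)'s difference formula and telescoping. [folklore] -/
theorem flow_shift_monotone_of_fading (hmono : ∀ u v : ℕ → ℝ, SeqBox γ u → SeqBox γ v → (∀ j, u j ≤ v j) → B u ≤ B v)
    (hL : ∀ k, 0 ≤ L k) (hb : 0 < b) (hlo : ∀ u, SeqBox γ u → b ≤ B u) (hdom : ∀ u, SeqBox γ u → ∑ k ∈ range K, L k * u k ≤ B u)
    (hh : SeqBox γ h) (hf : MemFlow B gIR h) (hL0 : L 0 = 0) (hfade : ∀ k, 1 ≤ k → L (k + 1) ≤ L k)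
    {KL : ℕ → ℕ → ℕ → ℝ} (hKL : ∀ k n l, KL k n l = if 0 < k ∧ k < K ∧ l < k then L k * h (n + k) ^ 3 / 2 else 0)
    {KA : ℕ → ℕ → ℕ → ℝ} (hKA : ∀ i m l, KA i m l = KL i m l + KA (i + 1) m l) (hKAtop : ∀ m l, KA K m l = 0) (m l : ℕ) :
    KA 1 m (l + 1) ≤ KA 1 (m + 1) l := by
  have hpos : ∀ n, 0 < h n := fun n => (hh n).1
  obtain ⟨-, htop, -, hdiff⟩ := aggregate_undamped_tail hmono hL hb hlo hdom hh hf hL0 hKL hKA hKAtop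
  -- telescoping: KA 1 n l = Σ_{j<K} (KA 1 n (l+j) − KA 1 n (l+j+1))
  have htel : ∀ n l, KA 1 n l = ∑ j ∈ range K, (KA 1 n (l + j) - KA 1 n (l + j + 1)) := by
    intro n l
    have h1 : ∑ j ∈ range K, (KA 1 n (l + j) - KA 1 n (l + j + 1)) = KA 1 n (l + 0) - KA 1 n (l + K) :=
      sum_range_sub' (fun j => KA 1 n (l + j)) K
    rw [h1, add_zero, htop n (l + K) (by omega), sub_zero]
  rw [htel m (l + 1), htel (m + 1) l]
  refine sum_le_sum fun j _ => ?_
  rw [show l + 1 + j = l + j + 1 by omega, hdiff m (l + j + 1), hdiff (m + 1) (l + j)]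
  by_cases h2 : l + j + 1 + 1 < K
  · rw [if_pos h2, if_pos (by omega), show m + (l + j + 1 + 1) = m + 1 + (l + j + 1) by omega]
    have hc : 0 ≤ h (m + 1 + (l + j + 1)) ^ 3 / 2 := by have := hpos (m + 1 + (l + j + 1)); positivity
    have := hfade (l + j + 1) (by omega)
    rw [show l + j + 1 + 1 = l + j + 1 + 1 from rfl]
    calc L (l + j + 1 + 1) * h (m + 1 + (l + j + 1)) ^ 3 / 2 = L (l + j + 1 + 1) * (h (m + 1 + (l + j + 1)) ^ 3 / 2) := by ring
      _ ≤ L (l + j + 1) * (h (m + 1 + (l + j + 1)) ^ 3 / 2) := mul_le_mul_of_nonneg_right this hc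
      _ = L (l + j + 1) * h (m + 1 + (l + j + 1)) ^ 3 / 2 := by ring
  · rw [if_neg h2]
    split_ifs with h1
    · have := hL (l + j + 1); have := hpos (m + 1 + (l + j + 1)); positivity
    · exact le_rfl

/-- **EVERY FADING PROFILE, EVERY RANGE — THE UNDAMPED FIRST-ORDER END.**  `B` an isotone memory with floor `b > 0` dominating the profile `L ≥ 0` on the ages `< K`
(`L_0 = 0`), FADING from age one on (`L (k+1) ≤ L k` for `k ≥ 1`); `h` a box solution; the undamped lone kernels `KL k n l = [0<k<K, l<k]·L_kh_{n+k}³∕2`, their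
aggregates `KA` and reads `RA`; `e ≥ 0` non-increasing, ANY horizon `N`; `ε` the zero-tailed solution of `ε = e − RA 1 ε`.  THEN `0 ≤ ε ≤ e` at every pin — for
EVERY `K` (§1 with (E98c)'s `KA 1 m 0 ≤ 1∕(m+1)` and §2's shift domination). [folklore] -/
theorem flow_nonneg_fading_undamped (hmono : ∀ u v : ℕ → ℝ, SeqBox γ u → SeqBox γ v → (∀ j, u j ≤ v j) → B u ≤ B v)
    (hL : ∀ k, 0 ≤ L k) (hb : 0 < b) (hlo : ∀ u, SeqBox γ u → b ≤ B u) (hdom : ∀ u, SeqBox γ u → ∑ k ∈ range K, L k * u k ≤ B u)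
    (hh : SeqBox γ h) (hf : MemFlow B gIR h) (hL0 : L 0 = 0) (hfade : ∀ k, 1 ≤ k → L (k + 1) ≤ L k)
    {N : ℕ} {KL : ℕ → ℕ → ℕ → ℝ} (hKL : ∀ k n l, KL k n l = if 0 < k ∧ k < K ∧ l < k then L k * h (n + k) ^ 3 / 2 else 0)
    {KA : ℕ → ℕ → ℕ → ℝ} {RA : ℕ → (ℕ → ℝ) → ℕ → ℝ}
    (hRA : ∀ i v m, RA i v m = ∑ l ∈ range K, KA i m l * v (m + 1 + l))
    (hKA : ∀ i m l, KA i m l = KL i m l + KA (i + 1) m l) (hKAtop : ∀ m l, KA K m l = 0)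
    {e ε : ℕ → ℝ} (he0 : ∀ m, 0 ≤ e m) (hea : ∀ m, e (m + 1) ≤ e m)
    (hεt : ∀ m, N < m → ε m = 0) (hεrec : ∀ m, ε m = e m - RA 1 ε m) : ∀ m, 0 ≤ ε m ∧ ε m ≤ e m := by
  obtain ⟨hanti, htop, hA0, -⟩ := aggregate_undamped_tail hmono hL hb hlo hdom hh hf hL0 hKL hKA hKAtop
  have hA1 : ∀ n, KA 1 n 0 ≤ 1 := fun n => (hA0 n).trans (by
    rw [div_le_one (by positivity)]; have : (0 : ℝ) ≤ n := Nat.cast_nonneg n; linarith)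
  have hnn : ∀ n l, 0 ≤ KA 1 n l := tail_nonneg_of_anti (A := fun n l => KA 1 n l) hanti htop
  exact renewal_nonneg_of_shift_monotone (Kw := K) (A := fun n l => KA 1 n l) (R := RA 1) hnn htop hA1
    (fun n l => flow_shift_monotone_of_fading hmono hL hb hlo hdom hh hf hL0 hfade hKL hKA hKAtop n l) (hRA 1) he0 hea hεt hεrec

end Summit.QuantumFields.BalabanUV.Beta.EriceRemainderEnclosureHistoryAutonomyComparisonAgeCompositionShiftMonotoneFading

end
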